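import Summits.QuantumFields.YangMills.Theorems.LuscherReductionDressedRitzLiftLeakageForms
import Summits.QuantumFields.YangMills.Theorems.LuscherReductionDressedRitzOfOperatorPlateau
import Summits.QuantumFields.YangMills.Theorems.FemtoTransferGapEigenbasis
import Summits.QuantumFields.YangMills.Theorems.LuscherReductionRunningReductionKTPhysSpace
import HarnessLib

/-!
# Crux `DressedRitz` (stmt-QuantumFields-20205), line «polyakovlift», stub S-LEAK `stub_liftLeakage` — support II:
# the leakage clause (o4) IS a quasi-mode residual bound; slow/stiff split against the physical eigenbasis; what (o7) gives for free

Support module (fleet seat ym-20205-polyakovlift-s1; `--supports stmt-QuantumFields-20205`, helper, no closure claim) for the registered stub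
`Summit.QuantumFields.YangMills.Cruxes.DressedRitz.PolyakovLift.stub_liftLeakage`, i.e. clause (o4) of `OpPlat.PlateauClauses`
(tree `Theorems/LuscherReductionDressedRitzPlateauDefs.lean`) for the lifted channel vectors `u = u_i`:

  `‖K_β u‖²·‖u‖² − ⟨u, K_β u⟩² ≤ C (λ³/L²) λ₀² ‖u‖⁴`   (`K_β = transferApply β`, `λ₀ = levelValue su2Rep L β 0`, `λ = luscherLambda β L`).

FIXED-LATTICE functional analysis over the tree's physical subspace (`physSubmodule`, `l2Form`, `transferOp`, `exists_isPhys_eigenseq`),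
instantiating the operator-free layer `…LiftLeakageForms.lean`; no definition is introduced; the stub's clause texts are spelled verbatim.

* `variance_le_norm_mul_residual` ∕ `residual_le_of_leakage`: (o4) for a physical `u` ⟺ `∃ a, ‖K_βu − a·u‖² ≤ C(λ³/L²)λ₀²‖u‖²` — `u` is a
  QUASI-MODE of `K_β` with relative residual `√C·λ^{3/2}/L`, one order of `√λ` inside the slow level spacing `≍ ελλ₀/L`;
  **`leakageClause_of_residual`**: the press-button in the VERBATIM text of `PolyakovLift.LeakageClause k C β u`.
* `residual_split_eigenfamily` + `remainder_residual_le` + `exists_eigenfamily_dominating`: against the tree's complete physical eigenbasis the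
  squared residual is `Σ_{j<N} (levelValue j − a)²⟨u,ψ_j⟩² + ‖(K_β − a) r_N‖²`, `r_N = u − Σ_{j<N}⟨u,ψ_j⟩ψ_j`, with
  `‖K_β r_N‖² ≤ λ_N⟨r_N,K_βr_N⟩ ≤ λ_N²‖r_N‖²`; **`leakageClause_of_slow_stiff`**: the three-sector sufficient condition (slow weights × levers +
  stiff squared residual) in the stub's currency.
* `ins_normSq` ∕ `ins_form` ∕ `ins_normSq_apply`: TIME-2 CORRELATOR CURRENCY — for `u = OpPlat.ins φ O` with `φ` a raw vacuum (`‖φ‖ = 1`,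
  `K_βφ = λ₀φ`): `‖u‖² = ⟨Oφ,Oφ⟩ − c²`, `⟨u,K_βu⟩ = ⟨Oφ,K_β(Oφ)⟩ − λ₀c²`, `‖K_βu‖² = ‖K_β(Oφ)‖² − λ₀²c²` (`c = ⟨φ,Oφ⟩`), so (o4) is the
  log-convexity defect `G₀G₂ − G₁² ≤ C(λ³/L²)G₀²` of the vacuum-normalised connected two-point function `G_r = ⟨Oφ,(K_β/λ₀)^rOφ⟩ − c²` of the
  insertion at separations `r = 0, 1, 2` (effective-mass drift between the first two steps `≲ λ³/L²`; every `G_r` is an `m → ∞` slab ratio by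
  the vacuum dictionary).
* `variance_le_top_mul_spread` ∕ **`weakLeakage_of_spread`**: WHAT IS FREE — `K_β² ≤ λ₀K_β` on physical vectors gives
  `Var(u) ≤ ⟨u,K_βu⟩·(λ₀‖u‖² − ⟨u,K_βu⟩)`, so the time-1 spread clause (o7) `λ₀‖u‖² − ⟨u,K_βu⟩ ≤ C(λ/L)λ₀‖u‖²` (a conjunct of
  `PolyakovLift.DynamicClauses`) ALREADY yields (o4) with `λ/L` in place of `λ³/L²`.  The CONTENT of S-LEAK is exactly the upgrade
  `λ/L ↝ λ³/L²`: slow leakage weights `⟨u,ψ_j⟩²/‖u‖² = O(λ)` at levers `(λ_j − a)² ≍ (λ/L)²λ₀²`, plus a stiff squared residual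
  `‖(K_β − a)r_N‖² = O(λ³/L²)λ₀²‖u‖²` (the populated stiff states sit at `λ_N ≈ λ₀e^{−2π/L}`; the energy VARIANCE of the lifted state is `O(λ³/ℓ²)`
  uniformly in the cutoff) — renormalisation-group ∕ Born–Oppenheimer mathematics (Lüscher 1983 §3 made rigorous), NOT proved here.

HONEST FRAMING: bookkeeping on the conditional femto rung R2b1; fixed-lattice functional analysis only; the stub `stub_liftLeakage` stays OPEN;
nothing here bears on infinite volume, the continuum limit or the Clay gap.
References: T. Kato, J. Phys. Soc. Japan 4 (1949) 334 [cite: Kato1949, §1]; M. Reed, B. Simon IV (1978) Thm XIII.1–2 [cite: ReedSimonIV1978];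
M. Lüscher, U. Wolff, NPB 339 (1990) 222 [cite: LuscherWolff1990]; M. Lüscher, NPB 219 (1983) 233 [cite: Luscher1983, §3].
-/

set_option autoImplicit false

noncomputable section

open MeasureTheory Filter Topology Real Finset
open Literature.MathematicalPhysics.QuantumFieldTheory
open Literature.MathematicalPhysics.QuantumLattice
open Literature.Analysis.OperatorTheory
open scoped BigOperators

namespace Summit.QuantumFields.YangMills.Theorems.FemtoTransferGap.LiftLeak

/-! ## The femto transfer problem: (o4) ⟺ quasi-mode residual; split against the physical eigenbasis; what (o7) gives for free -/

section Femto

variable {L : ℕ} [NeZero L]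

/-- **(o4)'s left-hand side is `‖u‖²·‖K_βu − a·u‖² − (a‖u‖² − ⟨u,K_βu⟩)²` for every `a`** (physical `u`). [cite: Kato1949, §1] -/
theorem variance_eq_norm_mul_residual_sub_sq (β : ℝ) {u : GaugeConfig 3 L SU2 → ℝ} (hu : IsPhys u) (a : ℝ) :
    l2 (transferApply β u) (transferApply β u) * l2 u u - l2 u (transferApply β u) ^ 2 =
      l2 u u * l2 (transferApply β u - a • u) (transferApply β u - a • u) - (a * l2 u u - l2 u (transferApply β u)) ^ 2 := by
  have h := variance_eq_residual_sub_sq (l2Form L) l2Form_symm (transferOp β) ⟨u, hu⟩ a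
  simpa only [l2Form_apply, coe_transferOp, Submodule.coe_sub, Submodule.coe_smul, Submodule.coe_mk] using h

/-- **Variance ≤ ‖u‖² × squared residual**, every `a`: `‖K_βu‖²‖u‖² − ⟨u,K_βu⟩² ≤ ‖u‖²·‖K_βu − a·u‖²`. [cite: Kato1949, §1] -/
theorem variance_le_norm_mul_residual (β : ℝ) {u : GaugeConfig 3 L SU2 → ℝ} (hu : IsPhys u) (a : ℝ) :
    l2 (transferApply β u) (transferApply β u) * l2 u u - l2 u (transferApply β u) ^ 2 ≤
      l2 u u * l2 (transferApply β u - a • u) (transferApply β u - a • u) := by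
  rw [variance_eq_norm_mul_residual_sub_sq β hu a]
  nlinarith [sq_nonneg (a * l2 u u - l2 u (transferApply β u))]

/-- **A relative squared-residual bound gives the leakage inequality**: `‖K_βu − a·u‖² ≤ ϱ‖u‖²` for SOME `a` implies
`‖K_βu‖²‖u‖² − ⟨u,K_βu⟩² ≤ ϱ‖u‖⁴`. [cite: Kato1949, §1] -/
theorem leakage_of_residual (β : ℝ) {u : GaugeConfig 3 L SU2 → ℝ} (hu : IsPhys u) {ϱ a : ℝ}
    (h : l2 (transferApply β u - a • u) (transferApply β u - a • u) ≤ ϱ * l2 u u) :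
    l2 (transferApply β u) (transferApply β u) * l2 u u - l2 u (transferApply β u) ^ 2 ≤ ϱ * l2 u u ^ 2 := by
  have hn : 0 ≤ l2 u u := l2_self_nonneg u
  calc l2 (transferApply β u) (transferApply β u) * l2 u u - l2 u (transferApply β u) ^ 2
      ≤ l2 u u * l2 (transferApply β u - a • u) (transferApply β u - a • u) := variance_le_norm_mul_residual β hu a
    _ ≤ l2 u u * (ϱ * l2 u u) := mul_le_mul_of_nonneg_left h hn
    _ = ϱ * l2 u u ^ 2 := by ring

/-- **Converse (no loss)**: the leakage inequality with rate `ϱ` gives the squared-residual bound `‖K_βu − a·u‖² ≤ ϱ‖u‖²` at the Rayleigh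
quotient `a = ⟨u,K_βu⟩/‖u‖²` (`‖u‖² > 0`).  So (o4) for `u` is EQUIVALENT to "`u` is a quasi-mode of `K_β` with relative squared residual
`≤ C(λ³/L²)λ₀²`". [cite: Kato1949, §1] -/
theorem residual_le_of_leakage (β : ℝ) {u : GaugeConfig 3 L SU2 → ℝ} (hu : IsPhys u) (hn : 0 < l2 u u) {ϱ : ℝ}
    (h : l2 (transferApply β u) (transferApply β u) * l2 u u - l2 u (transferApply β u) ^ 2 ≤ ϱ * l2 u u ^ 2) :
    l2 (transferApply β u - (l2 u (transferApply β u) / l2 u u) • u)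
        (transferApply β u - (l2 u (transferApply β u) / l2 u u) • u) ≤ ϱ * l2 u u := by
  have hid := residual_rayleigh_eq_variance (l2Form L) l2Form_symm (transferOp β) ⟨u, hu⟩ (by simpa using hn.ne')
  simp only [l2Form_apply, coe_transferOp, Submodule.coe_sub, Submodule.coe_smul] at hid
  -- `‖u‖² · res = Var ≤ ϱ ‖u‖⁴`
  have h' : l2 u u * l2 (transferApply β u - (l2 u (transferApply β u) / l2 u u) • u)
      (transferApply β u - (l2 u (transferApply β u) / l2 u u) • u) ≤ l2 u u * (ϱ * l2 u u) :=
    calc _ = _ := hid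
      _ ≤ ϱ * l2 u u ^ 2 := h
      _ = l2 u u * (ϱ * l2 u u) := by ring
  exact le_of_mul_le_mul_left h' hn

/-- ★ **Press-button for S-LEAK in the stub's currency.**  For a family `u : Fin k → …` of physical vectors, per-vector squared-residual
bounds `∃ a_i, ‖K_β u_i − a_i·u_i‖² ≤ C(λ³/L²)λ₀²‖u_i‖²` give the VERBATIM text of `PolyakovLift.LeakageClause k C β u` (clause (o4) of
`OpPlat.PlateauClauses`). [cite: Kato1949, §1] [cite: LuscherWolff1990] -/
theorem leakageClause_of_residual {k : ℕ} (C β : ℝ) {u : Fin k → (GaugeConfig 3 L SU2 → ℝ)} (hu : ∀ i, IsPhys (u i))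
    (h : ∀ i : Fin k, ∃ a : ℝ, l2 (transferApply β (u i) - a • u i) (transferApply β (u i) - a • u i) ≤
      C * (luscherLambda β L ^ 3 / (L : ℝ) ^ 2) * levelValue su2Rep L β 0 ^ 2 * l2 (u i) (u i)) :
    ∀ i : Fin k,
      l2 (transferApply β (u i)) (transferApply β (u i)) * l2 (u i) (u i) - l2 (u i) (transferApply β (u i)) ^ 2
        ≤ C * (luscherLambda β L ^ 3 / (L : ℝ) ^ 2) * levelValue su2Rep L β 0 ^ 2 * l2 (u i) (u i) ^ 2 := by
  intro i
  obtain ⟨a, ha⟩ := h i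
  exact leakage_of_residual β (hu i) ha

/-- **The remainder `r_N = u − Σ_{j<N} ⟨u,ψ_j⟩ψ_j` is orthogonal to the family** (`ψ` `l2`-orthonormal, all physical). [folklore] -/
theorem l2_remainder_eq_zero {N : ℕ} {ψ : Fin N → (GaugeConfig 3 L SU2 → ℝ)} (hψ : ∀ j, IsPhys (ψ j))
    (hon : ∀ i l, l2 (ψ i) (ψ l) = if i = l then 1 else 0) {u : GaugeConfig 3 L SU2 → ℝ} (hu : IsPhys u) (l : Fin N) :
    l2 (u - ∑ j, l2 u (ψ j) • ψ j) (ψ l) = 0 := by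
  have h := ip_remainder_eq_zero (l2Form L) (fun j => (⟨ψ j, hψ j⟩ : physSubmodule L))
    (fun i l => by simpa only [l2Form_apply, Submodule.coe_mk] using hon i l) ⟨u, hu⟩ l
  simpa only [l2Form_apply, Submodule.coe_sub, Submodule.coe_sum, Submodule.coe_smul, Submodule.coe_mk] using h

/-- ★ **Pythagorean split of the squared residual against a finite exact physical eigenfamily.**  `ψ_0 … ψ_{N−1}` physical,
`l2`-orthonormal, `K_β ψ_j = λ_j ψ_j`.  For every physical `u` and every `a`, with `r_N = u − Σ_j ⟨u,ψ_j⟩ψ_j`: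
`‖K_βu − a·u‖² = Σ_{j<N} (λ_j − a)²⟨u,ψ_j⟩² + ‖K_β r_N − a·r_N‖²` — SLOW leakage (explicit levels × weights) + the STIFF squared residual, no
cross term. [cite: ReedSimonIV1978, Thm XIII.1] -/
theorem residual_split_eigenfamily (β : ℝ) {N : ℕ} {ψ : Fin N → (GaugeConfig 3 L SU2 → ℝ)} (hψ : ∀ j, IsPhys (ψ j))
    (hon : ∀ i l, l2 (ψ i) (ψ l) = if i = l then 1 else 0) (ev : Fin N → ℝ)
    (heig : ∀ j, transferApply β (ψ j) = ev j • ψ j) {u : GaugeConfig 3 L SU2 → ℝ} (hu : IsPhys u) (a : ℝ) :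
    l2 (transferApply β u - a • u) (transferApply β u - a • u) =
      ∑ j, (ev j - a) ^ 2 * l2 u (ψ j) ^ 2 +
        l2 (transferApply β (u - ∑ j, l2 u (ψ j) • ψ j) - a • (u - ∑ j, l2 u (ψ j) • ψ j))
          (transferApply β (u - ∑ j, l2 u (ψ j) • ψ j) - a • (u - ∑ j, l2 u (ψ j) • ψ j)) := by
  set e : Fin N → physSubmodule L := fun j => ⟨ψ j, hψ j⟩ with he
  have hon' : ∀ i l, l2Form L (e i) (e l) = if i = l then 1 else 0 := fun i l => by
    simpa only [l2Form_apply, he, Submodule.coe_mk] using hon i l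
  have heig' : ∀ j, transferOp β (e j) = ev j • e j := fun j => by
    apply Subtype.ext
    simpa only [coe_transferOp, Submodule.coe_smul, he, Submodule.coe_mk] using heig j
  have h := residual_split (l2Form L) l2Form_symm (transferOp β) (transferOp_symm β) e ev hon' heig' ⟨u, hu⟩ a
  simpa only [l2Form_apply, coe_transferOp, Submodule.coe_sub, Submodule.coe_sum, Submodule.coe_smul, Submodule.coe_mk, he]
    using h

/-- ★ **The stiff sector: `K_β² ≤ λ_N K_β ≤ λ_N²` beyond the first `N` levels.**  If every physical `φ ⊥ ψ_0 … ψ_{N−1}` has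
`⟨φ,K_βφ⟩ ≤ Λ‖φ‖²` (Courant–Fischer domination, `Λ = levelValue N` for the tree's eigenbasis), `Λ ≥ 0`, `β ≥ 0`, then for every physical
`r ⊥ ψ`: `‖K_β r‖² ≤ Λ⟨r,K_βr⟩`, `‖K_β r‖² ≤ Λ²‖r‖²`, and `‖K_βr − a·r‖² ≤ max(a²,(Λ−a)²)‖r‖²` for every `a`.
[cite: ReedSimonIV1978, Thm XIII.1] -/
theorem remainder_residual_le {β : ℝ} (hβ : 0 ≤ β) {N : ℕ} {ψ : Fin N → (GaugeConfig 3 L SU2 → ℝ)} (hψ : ∀ j, IsPhys (ψ j))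
    (ev : Fin N → ℝ) (heig : ∀ j, transferApply β (ψ j) = ev j • ψ j) {Λ : ℝ} (hΛ : 0 ≤ Λ)
    (hdom : ∀ φ : GaugeConfig 3 L SU2 → ℝ, IsPhys φ → (∀ j, l2 φ (ψ j) = 0) → l2 φ (transferApply β φ) ≤ Λ * l2 φ φ)
    {r : GaugeConfig 3 L SU2 → ℝ} (hr : IsPhys r) (hrψ : ∀ j, l2 r (ψ j) = 0) (a : ℝ) :
    l2 (transferApply β r) (transferApply β r) ≤ Λ * l2 r (transferApply β r) ∧
      l2 (transferApply β r) (transferApply β r) ≤ Λ ^ 2 * l2 r r ∧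
        l2 (transferApply β r - a • r) (transferApply β r - a • r) ≤ max (a ^ 2) ((Λ - a) ^ 2) * l2 r r := by
  set e : Fin N → physSubmodule L := fun j => ⟨ψ j, hψ j⟩ with he
  have heig' : ∀ j, transferOp β (e j) = ev j • e j := fun j => by
    apply Subtype.ext
    simpa only [coe_transferOp, Submodule.coe_smul, he, Submodule.coe_mk] using heig j
  -- the class `P y := y ⊥ e`, stable under `K_β`, dominated by `Λ`
  set P : physSubmodule L → Prop := fun y => ∀ j, l2Form L y (e j) = 0 with hP
  have hPK : ∀ y, P y → P (transferOp β y) := fun y hy j =>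
    ip_apply_eigen_eq_zero (l2Form L) (transferOp β) (transferOp_symm β) e ev heig' hy j
  have hdom' : ∀ y, P y → l2Form L y (transferOp β y) ≤ Λ * l2Form L y y := fun y hy => by
    simpa only [l2Form_apply, coe_transferOp] using
      hdom y (isPhys_coe y) (fun j => by simpa only [l2Form_apply, he, Submodule.coe_mk] using hy j)
  have hpos : ∀ y : physSubmodule L, 0 ≤ l2Form L y (transferOp β y) := l2Form_self_transferOp_nonneg hβ
  have hrP : P ⟨r, hr⟩ := fun j => by simpa only [l2Form_apply, he, Submodule.coe_mk] using hrψ j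
  have h1 := form_sq_le_dom (l2Form L) l2Form_symm l2Form_self_nonneg (transferOp β) (transferOp_symm β) hpos P hPK hΛ
    hdom' hrP
  have h2 := form_sq_le_dom_sq (l2Form L) l2Form_symm l2Form_self_nonneg (transferOp β) (transferOp_symm β) hpos P hPK hΛ
    hdom' hrP
  have h3 := residual_remainder_le (l2Form L) l2Form_symm l2Form_self_nonneg (transferOp β) (transferOp_symm β) hpos P hPK
    hΛ hdom' hrP a
  simp only [l2Form_apply, coe_transferOp, Submodule.coe_sub, Submodule.coe_smul] at h1 h2 h3
  exact ⟨h1, h2, h3⟩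

/-- ★ **The tree supplies the eigenfamilies**: for `β > 0` and every `N` there is a physical `l2`-orthonormal exact eigenfamily
`ψ_0 … ψ_{N−1}` with `K_β ψ_j = levelValue j · ψ_j` which DOMINATES at level `N`: every physical `φ ⊥ ψ` has `⟨φ,K_βφ⟩ ≤ levelValue N · ‖φ‖²`
(the first `N` members of `PhysL2.exists_isPhys_eigenseq`). [cite: ReedSimonIV1978, Thm XIII.1–2] -/
theorem exists_eigenfamily_dominating {β : ℝ} (hβ : 0 < β) (N : ℕ) :
    ∃ ψ : Fin N → (GaugeConfig 3 L SU2 → ℝ), (∀ j, IsPhys (ψ j)) ∧ (∀ i l, l2 (ψ i) (ψ l) = if i = l then 1 else 0) ∧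
      (∀ j : Fin N, transferApply β (ψ j) = levelValue su2Rep L β j • ψ j) ∧
      ∀ φ : GaugeConfig 3 L SU2 → ℝ, IsPhys φ → (∀ j, l2 φ (ψ j) = 0) →
        l2 φ (transferApply β φ) ≤ levelValue su2Rep L β N * l2 φ φ := by
  obtain ⟨e, hon, heig, hdom, -⟩ := exists_isPhys_eigenseq (L := L) hβ
  refine ⟨fun j => (e j : GaugeConfig 3 L SU2 → ℝ), fun j => isPhys_coe _, fun i l => ?_, fun j => heig j, fun φ hφ horth => ?_⟩
  · rw [hon]
    simp only [Fin.val_inj]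
  · rw [← qform_eq_l2_transferApply]
    exact hdom N φ hφ fun i hi => horth ⟨i, hi⟩

/-- ★★ **Three-sector sufficient condition for S-LEAK (the currency in which the RG estimate must be delivered).**  Family `u` physical;
for each `i` an exact physical `l2`-orthonormal eigenfamily `ψ` (levels `λ_j`, any length `N`), an approximate eigenvalue `a`, and the bound
SLOW + STIFF: `Σ_{j<N} (λ_j − a)²⟨u_i,ψ_j⟩² + ‖(K_β − a) r_{i,N}‖² ≤ C(λ³/L²)λ₀²‖u_i‖²` (`r_{i,N} = u_i − Σ⟨u_i,ψ_j⟩ψ_j`).  Then the VERBATIM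
`PolyakovLift.LeakageClause k C β u`.  (With `exists_eigenfamily_dominating` and `remainder_residual_le` the stiff term is further bounded by
`max(a²,(λ_N−a)²)‖r_{i,N}‖²`; the physics of S-LEAK is that slow weights are `O(λ)` at levers `(λ_j−a)² ≍ λ²λ₀²/L²` and that the populated stiff
states sit at `λ_N ≈ λ₀e^{−2π/L}` with total squared residual `O(λ³/L²)λ₀²‖u‖²` — NOT proved here.) [cite: Luscher1983, §3] [cite: LuscherWolff1990] -/
theorem leakageClause_of_slow_stiff {k : ℕ} (C β : ℝ) {u : Fin k → (GaugeConfig 3 L SU2 → ℝ)} (hu : ∀ i, IsPhys (u i))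
    (h : ∀ i : Fin k, ∃ (N : ℕ) (ψ : Fin N → (GaugeConfig 3 L SU2 → ℝ)) (ev : Fin N → ℝ) (a : ℝ),
      (∀ j, IsPhys (ψ j)) ∧ (∀ j l, l2 (ψ j) (ψ l) = if j = l then 1 else 0) ∧
      (∀ j, transferApply β (ψ j) = ev j • ψ j) ∧
      ∑ j, (ev j - a) ^ 2 * l2 (u i) (ψ j) ^ 2 +
        l2 (transferApply β (u i - ∑ j, l2 (u i) (ψ j) • ψ j) - a • (u i - ∑ j, l2 (u i) (ψ j) • ψ j))
          (transferApply β (u i - ∑ j, l2 (u i) (ψ j) • ψ j) - a • (u i - ∑ j, l2 (u i) (ψ j) • ψ j))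
        ≤ C * (luscherLambda β L ^ 3 / (L : ℝ) ^ 2) * levelValue su2Rep L β 0 ^ 2 * l2 (u i) (u i)) :
    ∀ i : Fin k,
      l2 (transferApply β (u i)) (transferApply β (u i)) * l2 (u i) (u i) - l2 (u i) (transferApply β (u i)) ^ 2
        ≤ C * (luscherLambda β L ^ 3 / (L : ℝ) ^ 2) * levelValue su2Rep L β 0 ^ 2 * l2 (u i) (u i) ^ 2 := by
  refine leakageClause_of_residual C β hu fun i => ?_
  obtain ⟨N, ψ, ev, a, hψ, hon, heig, hle⟩ := h i
  exact ⟨a, by rw [residual_split_eigenfamily β hψ hon ev heig (hu i) a]; exact hle⟩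

/-- **What is free I: variance ≤ ⟨u,K_βu⟩ × spread** for every physical `u` (`β > 0`): `K_β² ≤ λ₀K_β` on the physical subspace
(Cauchy–Schwarz for the transfer form + `⟨φ,K_βφ⟩ ≤ λ₀‖φ‖²`). [cite: Kato1949, §1] [cite: ReedSimonIV1978, Thm XIII.1] -/
theorem variance_le_top_mul_spread {β : ℝ} (hβ : 0 < β) {u : GaugeConfig 3 L SU2 → ℝ} (hu : IsPhys u) :
    l2 (transferApply β u) (transferApply β u) * l2 u u - l2 u (transferApply β u) ^ 2 ≤
      l2 u (transferApply β u) * (levelValue su2Rep L β 0 * l2 u u - l2 u (transferApply β u)) := by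
  obtain ⟨ψ, -, -, -, hdom⟩ := exists_eigenfamily_dominating (L := L) hβ 0
  have hdom' : ∀ y : physSubmodule L, l2Form L y (transferOp β y) ≤ levelValue su2Rep L β 0 * l2Form L y y := fun y => by
    simpa only [l2Form_apply, coe_transferOp] using hdom y (isPhys_coe y) (fun j => Fin.elim0 j)
  have h := variance_le_form_mul_spread (l2Form L) l2Form_symm l2Form_self_nonneg (transferOp β) (transferOp_symm β)
    (l2Form_self_transferOp_nonneg hβ.le) (levelValue_su2Rep_nonneg L hβ.le 0) hdom' ⟨u, hu⟩
  simpa only [l2Form_apply, coe_transferOp, Submodule.coe_mk] using h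

/-- ★ **What is free II: the time-1 SPREAD clause (o7) already gives leakage at rate `λ/L`.**  If `λ₀‖u_i‖² − ⟨u_i,K_βu_i⟩ ≤ C(λ/L)λ₀‖u_i‖²`
(VERBATIM conjunct (o7) of `PolyakovLift.DynamicClauses`) then `‖K_βu_i‖²‖u_i‖² − ⟨u_i,K_βu_i⟩² ≤ C(λ/L)λ₀²‖u_i‖⁴` — clause (o4) with `λ/L` in
place of `λ³/L²`.  The content of S-LEAK is exactly the missing factor `λ²/L` (one order of `λ` inside the squared slow level spacing).
[cite: Kato1949, §1] [cite: Luscher1983, §3] -/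
theorem weakLeakage_of_spread {k : ℕ} (C : ℝ) {β : ℝ} (hβ : 0 < β) {u : Fin k → (GaugeConfig 3 L SU2 → ℝ)}
    (hu : ∀ i, IsPhys (u i))
    (h7 : ∀ i : Fin k, levelValue su2Rep L β 0 * l2 (u i) (u i) - l2 (u i) (transferApply β (u i))
      ≤ C * (luscherLambda β L / L) * levelValue su2Rep L β 0 * l2 (u i) (u i)) :
    ∀ i : Fin k,
      l2 (transferApply β (u i)) (transferApply β (u i)) * l2 (u i) (u i) - l2 (u i) (transferApply β (u i)) ^ 2
        ≤ C * (luscherLambda β L / L) * levelValue su2Rep L β 0 ^ 2 * l2 (u i) (u i) ^ 2 := by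
  intro i
  obtain ⟨ψ, -, -, -, hdom⟩ := exists_eigenfamily_dominating (L := L) hβ 0
  have hd0 : 0 ≤ l2 (u i) (transferApply β (u i)) := by
    rw [← qform_eq_l2_transferApply]; exact qform_su2Rep_self_nonneg hβ.le (hu i)
  have hdle : l2 (u i) (transferApply β (u i)) ≤ levelValue su2Rep L β 0 * l2 (u i) (u i) :=
    hdom (u i) (hu i) (fun j => Fin.elim0 j)
  have hv := variance_le_top_mul_spread hβ (hu i)
  -- `X := C(λ/L)λ₀‖u‖² ≥ λ₀‖u‖² − d ≥ 0`
  have hX : 0 ≤ C * (luscherLambda β L / L) * levelValue su2Rep L β 0 * l2 (u i) (u i) := by linarith [h7 i]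
  calc l2 (transferApply β (u i)) (transferApply β (u i)) * l2 (u i) (u i) - l2 (u i) (transferApply β (u i)) ^ 2
      ≤ l2 (u i) (transferApply β (u i)) * (levelValue su2Rep L β 0 * l2 (u i) (u i) - l2 (u i) (transferApply β (u i))) := hv
    _ ≤ l2 (u i) (transferApply β (u i)) * (C * (luscherLambda β L / L) * levelValue su2Rep L β 0 * l2 (u i) (u i)) :=
        mul_le_mul_of_nonneg_left (h7 i) hd0
    _ ≤ (levelValue su2Rep L β 0 * l2 (u i) (u i)) * (C * (luscherLambda β L / L) * levelValue su2Rep L β 0 * l2 (u i) (u i)) :=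
        mul_le_mul_of_nonneg_right hdle hX
    _ = C * (luscherLambda β L / L) * levelValue su2Rep L β 0 ^ 2 * l2 (u i) (u i) ^ 2 := by ring

/-- **Time-2 correlator currency, norm**: for `u = ins φ O = (O − c)φ`, `c = ⟨φ,Oφ⟩`, `‖φ‖² = 1`: `‖u‖² = ⟨Oφ,Oφ⟩ − c²`. [cite: LuscherWolff1990] -/
theorem ins_normSq {φ O : GaugeConfig 3 L SU2 → ℝ} (hφ : IsPhys φ) (hO : IsPhys O) (hφ1 : l2 φ φ = 1) :
    l2 (OpPlat.ins φ O) (OpPlat.ins φ O) = l2 (O * φ) (O * φ) - l2 φ (O * φ) ^ 2 := by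
  set Φ : physSubmodule L := ⟨φ, hφ⟩ with hΦ
  set OΦ : physSubmodule L := ⟨O * φ, OpPlat.isPhys_mul hO hφ⟩ with hOΦ
  have hins : OpPlat.ins φ O = ((OΦ - l2 φ (O * φ) • Φ : physSubmodule L) : GaugeConfig 3 L SU2 → ℝ) := by
    rw [OpPlat.ins_eq]; rfl
  have hc : l2Form L OΦ Φ = l2 φ (O * φ) := by rw [l2Form_apply, l2_comm]
  have hc' : l2Form L Φ OΦ = l2 φ (O * φ) := by rw [l2Form_symm]; exact hc
  have h1 : l2Form L Φ Φ = 1 := by simpa [l2Form_apply] using hφ1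
  have h : l2Form L (OΦ - l2 φ (O * φ) • Φ) (OΦ - l2 φ (O * φ) • Φ) = l2Form L OΦ OΦ - l2 φ (O * φ) ^ 2 := by
    simp only [map_sub, map_smul, LinearMap.sub_apply, LinearMap.smul_apply, smul_eq_mul, hc, hc', h1]
    ring
  rw [hins, ← l2Form_apply, h, l2Form_apply]

/-- **Time-2 correlator currency, one step**: with moreover `K_βφ = λ₀φ`: `⟨u,K_βu⟩ = ⟨Oφ,K_β(Oφ)⟩ − λ₀c²`. [cite: LuscherWolff1990] -/
theorem ins_form (β : ℝ) {φ O : GaugeConfig 3 L SU2 → ℝ} (hφ : IsPhys φ) (hO : IsPhys O) (hφ1 : l2 φ φ = 1)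
    (heig : transferApply β φ = levelValue su2Rep L β 0 • φ) :
    l2 (OpPlat.ins φ O) (transferApply β (OpPlat.ins φ O)) =
      l2 (O * φ) (transferApply β (O * φ)) - levelValue su2Rep L β 0 * l2 φ (O * φ) ^ 2 := by
  set Φ : physSubmodule L := ⟨φ, hφ⟩ with hΦ
  set OΦ : physSubmodule L := ⟨O * φ, OpPlat.isPhys_mul hO hφ⟩ with hOΦ
  have hins : OpPlat.ins φ O = ((OΦ - l2 φ (O * φ) • Φ : physSubmodule L) : GaugeConfig 3 L SU2 → ℝ) := by
    rw [OpPlat.ins_eq]; rfl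
  have hK : transferOp β Φ = levelValue su2Rep L β 0 • Φ := Subtype.ext (by simpa [coe_transferOp] using heig)
  have hc : l2Form L OΦ Φ = l2 φ (O * φ) := by rw [l2Form_apply, l2_comm]
  have hc' : l2Form L Φ OΦ = l2 φ (O * φ) := by rw [l2Form_symm]; exact hc
  have h1 : l2Form L Φ Φ = 1 := by simpa [l2Form_apply] using hφ1
  have hΦK : l2Form L Φ (transferOp β OΦ) = levelValue su2Rep L β 0 * l2 φ (O * φ) := by
    rw [← transferOp_symm, hK, map_smul, LinearMap.smul_apply, smul_eq_mul, hc']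
  have h : l2Form L (OΦ - l2 φ (O * φ) • Φ) (transferOp β (OΦ - l2 φ (O * φ) • Φ)) =
      l2Form L OΦ (transferOp β OΦ) - levelValue su2Rep L β 0 * l2 φ (O * φ) ^ 2 := by
    simp only [map_sub, map_smul, LinearMap.sub_apply, LinearMap.smul_apply, smul_eq_mul, hK, hΦK, hc, h1]
    ring
  have hcoe : transferApply β (OpPlat.ins φ O) = ((transferOp β (OΦ - l2 φ (O * φ) • Φ) : physSubmodule L) : GaugeConfig 3 L SU2 → ℝ) := by
    rw [hins, coe_transferOp]
  rw [hcoe, hins, ← l2Form_apply, h, l2Form_apply, coe_transferOp]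

/-- **Time-2 correlator currency, two steps**: `‖K_βu‖² = ‖K_β(Oφ)‖² − λ₀²c²`.  Hence (o4) for `u = ins φ O` reads
`(‖K_β(Oφ)‖² − λ₀²c²)(‖Oφ‖² − c²) − (⟨Oφ,K_β(Oφ)⟩ − λ₀c²)² ≤ C(λ³/L²)λ₀²(‖Oφ‖² − c²)²` — the log-convexity defect of the connected two-point
function of `O` at separations `0, 1, 2`. [cite: LuscherWolff1990] -/
theorem ins_normSq_apply (β : ℝ) {φ O : GaugeConfig 3 L SU2 → ℝ} (hφ : IsPhys φ) (hO : IsPhys O) (hφ1 : l2 φ φ = 1)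
    (heig : transferApply β φ = levelValue su2Rep L β 0 • φ) :
    l2 (transferApply β (OpPlat.ins φ O)) (transferApply β (OpPlat.ins φ O)) =
      l2 (transferApply β (O * φ)) (transferApply β (O * φ)) - levelValue su2Rep L β 0 ^ 2 * l2 φ (O * φ) ^ 2 := by
  set Φ : physSubmodule L := ⟨φ, hφ⟩ with hΦ
  set OΦ : physSubmodule L := ⟨O * φ, OpPlat.isPhys_mul hO hφ⟩ with hOΦ
  have hins : OpPlat.ins φ O = ((OΦ - l2 φ (O * φ) • Φ : physSubmodule L) : GaugeConfig 3 L SU2 → ℝ) := by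
    rw [OpPlat.ins_eq]; rfl
  have hK : transferOp β Φ = levelValue su2Rep L β 0 • Φ := Subtype.ext (by simpa [coe_transferOp] using heig)
  have hc : l2Form L OΦ Φ = l2 φ (O * φ) := by rw [l2Form_apply, l2_comm]
  have hc' : l2Form L Φ OΦ = l2 φ (O * φ) := by rw [l2Form_symm]; exact hc
  have h1 : l2Form L Φ Φ = 1 := by simpa [l2Form_apply] using hφ1
  have hΦK : l2Form L Φ (transferOp β OΦ) = levelValue su2Rep L β 0 * l2 φ (O * φ) := by
    rw [← transferOp_symm, hK, map_smul, LinearMap.smul_apply, smul_eq_mul, hc']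
  have hKΦ : l2Form L (transferOp β OΦ) Φ = levelValue su2Rep L β 0 * l2 φ (O * φ) := by rw [l2Form_symm]; exact hΦK
  have h : l2Form L (transferOp β (OΦ - l2 φ (O * φ) • Φ)) (transferOp β (OΦ - l2 φ (O * φ) • Φ)) =
      l2Form L (transferOp β OΦ) (transferOp β OΦ) - levelValue su2Rep L β 0 ^ 2 * l2 φ (O * φ) ^ 2 := by
    simp only [map_sub, map_smul, LinearMap.sub_apply, LinearMap.smul_apply, smul_eq_mul, hK, hΦK, hKΦ, h1]
    ring
  have hcoe : transferApply β (OpPlat.ins φ O) = ((transferOp β (OΦ - l2 φ (O * φ) • Φ) : physSubmodule L) : GaugeConfig 3 L SU2 → ℝ) := by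
    rw [hins, coe_transferOp]
  rw [hcoe, ← l2Form_apply, h, l2Form_apply, coe_transferOp]

end Femto

end Summit.QuantumFields.YangMills.Theorems.FemtoTransferGap.LiftLeak

end
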